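import Literature.AlgebraicGeometry.Milne1999.LefschetzGroupOneEqSimilitudeCentralizer
import Literature.AlgebraicGeometry.Deligne1982.WeilTypeCMMumfordTateGroupOnH1
import Literature.AlgebraicGeometry.VanGeemen1994.WeilTypeGeneralMemberLefschetzGroup
import HarnessLib

/-!
# The general Weil-type abelian variety on `H¹`: `G(A)(ℂ) = L(A)(ℂ)|_{H¹} = ℂˣ · U(φ)(ℂ) ⊋ ℂˣ · SU(φ)(ℂ) = MT(A)(ℂ)|_{H¹}`

Milne [Milne2025AbelianMotivesCharP, §1.5 Example 1.17]: for a general polarized abelian variety `(A, ν, λ)` of Weil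
type relative to a CM field `E`, «there is an exact commutative diagram `SU(φ) ↪ MT(A)`, `GU(φ) ↪ L(A)` … for a
general `A`, the Weil classes are Hodge classes but not Lefschetz classes». Milne [Milne1999LefschetzClasses, §4
p. 659, Thm. 4.4]: `L(A) ≅ G(A)` = the centraliser of `End⁰(A)` in the group of similitudes of the polarization,
`ker l(A) = S(A)`; p. 660: `L(A) ⊃ Hg(A)`.

On the tree's carriers (all `theorem`s, no definition, no named fact), for `(A, η, h)` of Weil type relative to
`E = ℚ(η)` (`IsWeilTypeCM A η R e₀ k`, `h` a polarization class with the Rosati condition) with `Hg(A) = SU(φ)`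
(`HasHodgeGroupSUCM`) and `k ≥ 2`:
* **`G(A)(ℂ) = ℂˣ · U(φ)(ℂ)`** («`GU(φ) ≅ L(A)`», read on `H¹`: the tree's `similitudeCentralizerGroup A h`; from
  `S(A)(ℂ) = U(φ)(ℂ)`, `IsWeilTypeCM.unitaryCentralizerGroup_eq_weilUnitaryGroupCM_of_hodgeGroupSU`, and
  `G = ℂˣ · S`, `Milne1999.mem_similitudeCentralizerGroup_iff_exists_smulOfUnit_mul`), and
  **`L(A)(ℂ)|_{H¹} = ℂˣ · U(φ)(ℂ)`** when `h` has a Kähler multiple (Milne's Thm. 4.4 for `L(A)` on `H¹`,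
  `Milne1999.mem_map_lefschetzGroup_one_iff`);
* **`MT(A)(ℂ)|_{H¹} ⊊ G(A)(ℂ)`** and **`MT(A)(ℂ)|_{H¹} ⊊ L(A)(ℂ)|_{H¹}`**: `MT|_{H¹} = ℂˣ · SU(φ)(ℂ)` does not contain
  `U(φ)(ℂ) = S(A)(ℂ)` (`IsWeilTypeCM.not_unitaryCentralizerGroup_le_map_mumfordTateGroup_of_hodgeGroupSU`) — the two
  rows of Milne's diagram differ on `H¹` by `U(φ)/SU(φ)`, not only by the scalars;
* the quadratic case (`K = ℚ(√-d)`, van Geemen's `Hg = SU_H`, `n ≥ 2`): `G(A)(ℂ) = ℂˣ · U_H(ℂ)` and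
  `L(A)(ℂ)|_{H¹} = ℂˣ · U_H(ℂ)`.

## References

* [Milne2025AbelianMotivesCharP] J. S. Milne, *Abelian motives in characteristic p*, arXiv:2508.09972, §1.5 Ex. 1.17.
* [Milne1999LefschetzClasses] J. S. Milne, *Lefschetz classes on abelian varieties*, Duke Math. J. 96 (1999), §1 p. 644,
  §4 p. 659 (G(A)), Thm. 4.4, p. 660, Prop. 4.8.
* [Deligne1982HodgeCycles] P. Deligne (notes by J. S. Milne), LNM 900 (1982), I Prop. 3.4, §4; Milne 2003 endnote 16.
* [vanGeemen1994HodgeAV] B. van Geemen, LNM 1594 (1994), 6.9, Thm. 6.11.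
-/

noncomputable section

open CategoryTheory Polynomial
open Literature.AlgebraicTopology.SingularHomology
open Literature.AlgebraicGeometry.Motives
open Literature.AlgebraicGeometry.HodgeTheory
open Literature.AlgebraicGeometry.VanGeemen1994
open Literature.AlgebraicGeometry.Milne1999

namespace Literature.AlgebraicGeometry.Deligne1982

section CM

variable {A : AbelianVariety ℂ} {η : A ⟶ A} {R : Polynomial ℤ} {e₀ k : ℕ} {h : complexBetti A.X 2}
  (hW : IsWeilTypeCM A η R e₀ k) (hpol : IsPolarizationClass A.dim A.X h) (hRos : IsRosatiCM A η h)

include hW hpol hRos in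
/-- **`G(A)(ℂ) = ℂˣ · U(φ)(ℂ)` FOR THE GENERAL CM-WEIL ABELIAN VARIETY** (`Hg(A) = SU(φ)`, `k ≥ 2`): Milne's `G(A)(ℂ)`
(automorphisms of `H¹(A(ℂ); ℂ)` commuting with `End(A)` and scaling `Q_h`) consists of the `c · u'`, `c ∈ ℂˣ`,
`u' ∈ U(φ)(ℂ)` — the bottom row «`GU(φ) ≅ L(A)`» of Milne's diagram read on `H¹`.
[cite: Milne2025AbelianMotivesCharP, §1.5 Example 1.17] [cite: Milne1999LefschetzClasses, §4 p. 659 and Thm. 4.4] -/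
theorem IsWeilTypeCM.mem_similitudeCentralizerGroup_iff_of_hodgeGroupSU (hk : 2 ≤ k)
    (hSU : HasHodgeGroupSUCM A η (R.comp (X ^ 2)) h) {u : complexBetti A.X 1 ≃ₗ[ℂ] complexBetti A.X 1} :
    u ∈ similitudeCentralizerGroup A h ↔
      ∃ c : ℂˣ, ∃ u' ∈ weilUnitaryGroupCM A η h, u = LinearEquiv.smulOfUnit c * u' := by
  rw [mem_similitudeCentralizerGroup_iff_exists_smulOfUnit_mul,
    hW.unitaryCentralizerGroup_eq_weilUnitaryGroupCM_of_hodgeGroupSU hpol hRos hk hSU]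

include hW hpol hRos in
/-- `U(φ)(ℂ) ≤ G(A)(ℂ)` for the general member (`k ≥ 2`). [cite: Milne1999LefschetzClasses, §4 p. 659]
[cite: Milne2025AbelianMotivesCharP, §1.5 Example 1.17] -/
theorem IsWeilTypeCM.weilUnitaryGroupCM_le_similitudeCentralizerGroup_of_hodgeGroupSU (hk : 2 ≤ k)
    (hSU : HasHodgeGroupSUCM A η (R.comp (X ^ 2)) h) :
    weilUnitaryGroupCM A η h ≤ similitudeCentralizerGroup A h :=
  (hW.weilUnitaryGroupCM_le_unitaryCentralizerGroup_of_hodgeGroupSU hpol hRos hk hSU).trans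
    unitaryCentralizerGroup_le_similitudeCentralizerGroup

include hW hpol hRos in
/-- **`L(A)(ℂ)|_{H¹} = ℂˣ · U(φ)(ℂ)` FOR THE GENERAL CM-WEIL ABELIAN VARIETY** (`k ≥ 2`; `h` with a Kähler multiple,
the hypothesis of the tree's Thm. 4.4 record): the degree-one components of the elements of Milne's Lefschetz group
are exactly the `c · u'`, `c ∈ ℂˣ`, `u' ∈ U(φ)(ℂ)`. [cite: Milne1999LefschetzClasses, Thm. 4.4 and p. 659]
[cite: Milne2025AbelianMotivesCharP, §1.5 Example 1.17] -/
theorem IsWeilTypeCM.mem_map_lefschetzGroup_one_iff_of_hodgeGroupSU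
    (hK : ∃ s : ℝ, 0 < s ∧ IsKaehlerClass A.dim A.X ((s : ℂ) • h)) (hk : 2 ≤ k)
    (hSU : HasHodgeGroupSUCM A η (R.comp (X ^ 2)) h) {u : complexBetti A.X 1 ≃ₗ[ℂ] complexBetti A.X 1} :
    u ∈ (lefschetzGroup A.dim A.X).map
        (Pi.evalMonoidHom (fun k : ℕ ↦ complexBetti A.X k ≃ₗ[ℂ] complexBetti A.X k) 1) ↔
      ∃ c : ℂˣ, ∃ u' ∈ weilUnitaryGroupCM A η h, u = LinearEquiv.smulOfUnit c * u' := by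
  rw [mem_map_lefschetzGroup_one_iff hpol.isRationalClass hK,
    hW.unitaryCentralizerGroup_eq_weilUnitaryGroupCM_of_hodgeGroupSU hpol hRos hk hSU]

include hW hpol hRos in
/-- `U(φ)(ℂ) ≤ L(A)(ℂ)|_{H¹}` for the general member (`k ≥ 2`, `h` with a Kähler multiple).
[cite: Milne1999LefschetzClasses, Thm. 4.4] [cite: Milne2025AbelianMotivesCharP, §1.5 Example 1.17] -/
theorem IsWeilTypeCM.weilUnitaryGroupCM_le_lefschetzGroup_map_one_of_hodgeGroupSU
    (hK : ∃ s : ℝ, 0 < s ∧ IsKaehlerClass A.dim A.X ((s : ℂ) • h)) (hk : 2 ≤ k)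
    (hSU : HasHodgeGroupSUCM A η (R.comp (X ^ 2)) h) :
    weilUnitaryGroupCM A η h ≤ (lefschetzGroup A.dim A.X).map
      (Pi.evalMonoidHom (fun k : ℕ ↦ complexBetti A.X k ≃ₗ[ℂ] complexBetti A.X k) 1) :=
  (hW.weilUnitaryGroupCM_le_unitaryCentralizerGroup_of_hodgeGroupSU hpol hRos hk hSU).trans
    (unitaryCentralizerGroup_le_lefschetzGroup_map_one hpol.isRationalClass hK)

include hW hpol hRos in
/-- **`MT(A)(ℂ)|_{H¹} ⊊ G(A)(ℂ)` FOR THE GENERAL CM-WEIL ABELIAN VARIETY** (`k ≥ 2`): `MT|_{H¹} = ℂˣ · SU(φ)(ℂ)` lies in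
`G(A)(ℂ) = ℂˣ · U(φ)(ℂ)` («`L(A) ⊃ Hg(A)`») but does not contain `U(φ)(ℂ) = S(A)(ℂ)` — the top row
`SU(φ) ↪ MT(A)` of Milne's diagram is strictly smaller than the bottom row `GU(φ) ≅ L(A)` on `H¹`.
[cite: Milne2025AbelianMotivesCharP, §1.5 Example 1.17] [cite: Milne1999LefschetzClasses, §4 pp. 659–660 and Prop. 4.8] -/
theorem IsWeilTypeCM.map_mumfordTateGroup_one_lt_similitudeCentralizerGroup_of_hodgeGroupSU (hk : 2 ≤ k)
    (hSU : HasHodgeGroupSUCM A η (R.comp (X ^ 2)) h) :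
    (mumfordTateGroup A.dim A.X).map
        (Pi.evalMonoidHom (fun k : ℕ ↦ complexBetti A.X k ≃ₗ[ℂ] complexBetti A.X k) 1) <
      similitudeCentralizerGroup A h :=
  lt_of_le_of_ne
    (mumfordTateGroup_map_one_le_similitudeCentralizerGroup (mem_hodgeClassSpan_one_of_isPolarizationClass hW hpol))
    fun heq ↦ hW.not_unitaryCentralizerGroup_le_map_mumfordTateGroup_of_hodgeGroupSU hpol hRos hk hSU
      (unitaryCentralizerGroup_le_similitudeCentralizerGroup.trans heq.symm.le)

include hW hpol hRos in
/-- `MT(A)(ℂ)|_{H¹} ≠ G(A)(ℂ)` for the general CM-Weil abelian variety (`k ≥ 2`).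
[cite: Milne2025AbelianMotivesCharP, §1.5 Example 1.17] [cite: Milne1999LefschetzClasses, Prop. 4.8] -/
theorem IsWeilTypeCM.map_mumfordTateGroup_one_ne_similitudeCentralizerGroup_of_hodgeGroupSU (hk : 2 ≤ k)
    (hSU : HasHodgeGroupSUCM A η (R.comp (X ^ 2)) h) :
    (mumfordTateGroup A.dim A.X).map
        (Pi.evalMonoidHom (fun k : ℕ ↦ complexBetti A.X k ≃ₗ[ℂ] complexBetti A.X k) 1) ≠
      similitudeCentralizerGroup A h :=
  (hW.map_mumfordTateGroup_one_lt_similitudeCentralizerGroup_of_hodgeGroupSU hpol hRos hk hSU).ne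

include hW hpol hRos in
/-- **`MT(A)(ℂ)|_{H¹} ⊊ L(A)(ℂ)|_{H¹}` FOR THE GENERAL CM-WEIL ABELIAN VARIETY** (`k ≥ 2`, `h` with a Kähler multiple):
Milne's `Hg(A) ≠ L(A)` (Prop. 4.8 fails, the tree's `IsWeilTypeCM.mumfordTateGroup_lt_lefschetzGroup_of_hodgeGroupSU`)
persists after restriction to `H¹`. [cite: Milne2025AbelianMotivesCharP, §1.5 Example 1.17]
[cite: Milne1999LefschetzClasses, Thm. 4.4, p. 660 and Prop. 4.8] -/
theorem IsWeilTypeCM.map_mumfordTateGroup_one_lt_map_lefschetzGroup_one_of_hodgeGroupSU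
    (hK : ∃ s : ℝ, 0 < s ∧ IsKaehlerClass A.dim A.X ((s : ℂ) • h)) (hk : 2 ≤ k)
    (hSU : HasHodgeGroupSUCM A η (R.comp (X ^ 2)) h) :
    (mumfordTateGroup A.dim A.X).map
        (Pi.evalMonoidHom (fun k : ℕ ↦ complexBetti A.X k ≃ₗ[ℂ] complexBetti A.X k) 1) <
      (lefschetzGroup A.dim A.X).map
        (Pi.evalMonoidHom (fun k : ℕ ↦ complexBetti A.X k ≃ₗ[ℂ] complexBetti A.X k) 1) :=
  lt_of_le_of_ne mumfordTateGroup_map_one_le_lefschetzGroup_map_one fun heq ↦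
    hW.not_unitaryCentralizerGroup_le_map_mumfordTateGroup_of_hodgeGroupSU hpol hRos hk hSU
      ((unitaryCentralizerGroup_le_lefschetzGroup_map_one hpol.isRationalClass hK).trans heq.symm.le)

include hW hpol hRos in
/-- `MT(A)(ℂ)|_{H¹} ≠ L(A)(ℂ)|_{H¹}` for the general CM-Weil abelian variety (`k ≥ 2`, `h` with a Kähler multiple).
[cite: Milne2025AbelianMotivesCharP, §1.5 Example 1.17] [cite: Milne1999LefschetzClasses, Prop. 4.8] -/
theorem IsWeilTypeCM.map_mumfordTateGroup_one_ne_map_lefschetzGroup_one_of_hodgeGroupSU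
    (hK : ∃ s : ℝ, 0 < s ∧ IsKaehlerClass A.dim A.X ((s : ℂ) • h)) (hk : 2 ≤ k)
    (hSU : HasHodgeGroupSUCM A η (R.comp (X ^ 2)) h) :
    (mumfordTateGroup A.dim A.X).map
        (Pi.evalMonoidHom (fun k : ℕ ↦ complexBetti A.X k ≃ₗ[ℂ] complexBetti A.X k) 1) ≠
      (lefschetzGroup A.dim A.X).map
        (Pi.evalMonoidHom (fun k : ℕ ↦ complexBetti A.X k ≃ₗ[ℂ] complexBetti A.X k) 1) :=
  (hW.map_mumfordTateGroup_one_lt_map_lefschetzGroup_one_of_hodgeGroupSU hpol hRos hK hk hSU).ne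

end CM

end Literature.AlgebraicGeometry.Deligne1982

/-! ### The quadratic case (`K = ℚ(√-d)`, van Geemen's `Hg = SU_H`, `n ≥ 2`) -/

namespace Literature.AlgebraicGeometry.VanGeemen1994

section Quadratic

variable (A : AbelianVariety ℂ) (φ : A ⟶ A) (n d : ℕ) (e : ProjectiveEmbedding A.X)
  (a : complexBetti (projectiveSpace e.n ℂ) 2)

/-- **`G(A)(ℂ) = ℂˣ · U_H(ℂ)` for van Geemen's general Weil-type abelian variety** (`Hg = SU_H`, `n ≥ 2`), for every
class `h` (the tree's `unitaryCentralizerGroup_eq_weilUnitaryGroup_of_hasHodgeGroupSU`: `S(A)(h)(ℂ) = U_H(ℂ)`).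
[cite: Milne1999LefschetzClasses, §4 p. 659 and Thm. 4.4] [cite: vanGeemen1994HodgeAV, 6.9 and Thm. 6.11] -/
theorem mem_similitudeCentralizerGroup_iff_of_hasHodgeGroupSU (hn : 2 ≤ n) (hd : 0 < d) (hA : A.dim = 2 * n)
    (hφ : φ ≫ φ = -(d • 𝟙 A)) (ha : IsRationalClass a) (ha0 : a ≠ 0) (hSU : HasHodgeGroupSU A φ n d (hK d φ e a))
    (h : complexBetti A.X 2) {u : complexBetti A.X 1 ≃ₗ[ℂ] complexBetti A.X 1} :
    u ∈ similitudeCentralizerGroup A h ↔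
      ∃ c : ℂˣ, ∃ u' ∈ weilUnitaryGroup A φ n h, u = LinearEquiv.smulOfUnit c * u' := by
  rw [mem_similitudeCentralizerGroup_iff_exists_smulOfUnit_mul,
    unitaryCentralizerGroup_eq_weilUnitaryGroup_of_hasHodgeGroupSU A φ n d e a hn hd hA hφ ha ha0 hSU h]

/-- **`L(A)(ℂ)|_{H¹} = ℂˣ · U_H(ℂ)` for van Geemen's general member**, for a polarization class `h` (rational with a
Kähler multiple). [cite: Milne1999LefschetzClasses, Thm. 4.4 and p. 659] [cite: vanGeemen1994HodgeAV, 6.9 and Thm. 6.11] -/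
theorem mem_map_lefschetzGroup_one_iff_of_hasHodgeGroupSU (hn : 2 ≤ n) (hd : 0 < d) (hA : A.dim = 2 * n)
    (hφ : φ ≫ φ = -(d • 𝟙 A)) (ha : IsRationalClass a) (ha0 : a ≠ 0) (hSU : HasHodgeGroupSU A φ n d (hK d φ e a))
    {h : complexBetti A.X 2} (hQ : IsRationalClass h) (hKh : ∃ s : ℝ, 0 < s ∧ IsKaehlerClass A.dim A.X ((s : ℂ) • h))
    {u : complexBetti A.X 1 ≃ₗ[ℂ] complexBetti A.X 1} :
    u ∈ (lefschetzGroup A.dim A.X).map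
        (Pi.evalMonoidHom (fun k : ℕ ↦ complexBetti A.X k ≃ₗ[ℂ] complexBetti A.X k) 1) ↔
      ∃ c : ℂˣ, ∃ u' ∈ weilUnitaryGroup A φ n h, u = LinearEquiv.smulOfUnit c * u' := by
  rw [mem_map_lefschetzGroup_one_iff hQ hKh,
    unitaryCentralizerGroup_eq_weilUnitaryGroup_of_hasHodgeGroupSU A φ n d e a hn hd hA hφ ha ha0 hSU h]

end Quadratic

end Literature.AlgebraicGeometry.VanGeemen1994

end
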